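import Mathlib
import HarnessLib
import Summits.Langlands.Langlands.Theses.QuarterDeficit1951
import Literature.NumberTheory.GaloisRepresentations.HeckeCharacterProofs
import Literature.NumberTheory.GaloisRepresentations.ArtinConductorDischargeProofs
import Literature.NumberTheory.GaloisRepresentations.ArtinConductorHerbrandProofs
import Literature.NumberTheory.GaloisRepresentations.HasseArfProofs
import Literature.NumberTheory.GaloisRepresentations.DecompositionGroupOfCompletion
import Literature.NumberTheory.GaloisRepresentations.ArtinRestriction
import Literature.NumberTheory.GaloisRepresentations.WeilDeligneOfGaloisUnramifiedProofs

/-!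
# Sub-goal `stub_local1951_galois_conductor` of stub `stub_local1951_galois` (C1) of the crux
# `CorrespondentFingerprint` (stmt-Langlands-15898, line `Sketch`)

The GLOBAL half of the Galois side at `1951`: for a framed finite-image `ρ : Γ_ℚ → GL₂(ℚ̄_ℓ)` with
`N(ρ) = 1951`, unramified at every finite place `w` with `q_w ≠ 1951`, and the place `v` with
`q_v = 1951`, let `𝔓₀ = adicCompletionPrime ℚ v` (the prime of `\bar ℤ` above `v` cut out by the
chosen embedding `\bar ℚ → \bar ℚ_v`) and `I₀ = I_{𝔓₀} ≤ Γ_ℚ`.  Then some non-zero `e ∈ ℚ̄_ℓ²` is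
fixed by `ρ(I₀)`, `ρ(I₀) ≠ 1`, and `ρ(g)^m = 1` on `I₀` for some `m ≥ 1` with `1951 ∤ m`.

Proof.  `𝔣(ρ) = ∏ w^{a_w(ρ)} = v^{a_v(ρ)}` (the other exponents vanish at unramified places), so
`1951 = 1951^{a_v(ρ)}`, `a_v(ρ) = 1`, and by the integrality of the conductor exponent (Hasse–Arf
input `card_inf_inertia_dvd_finsum_card_inf_ramificationSubgroup_holds` assembled in
`natCast_artinConductorExponent_of_t2Space_of_arith_charZero`) `a_{𝔓₀}(ρ) = 1 = codim V^{I₀} + Sw`;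
`codim V^{I₀} = 0` would give `a_{𝔓₀} = 0`, so `codim V^{I₀} = 1` and `Sw = 0`.  Through a finite
Galois layer `Gal(E/ℚ)` (open kernel), the lower-numbering formula
`a_{𝔓₀} = Σ_i (g_i/g_0) codim V^{G_i}` has `i = 0` term `≥ codim V^{I₀}`, so its `i = 1` term
vanishes, `G_1` acts trivially, and the tame character `θ₀ : G_0 → (S/𝔓₀ ∩ E)ˣ` with kernel `G_1`
gives `ρ(g)^m = 1` on `I₀` for `m = #(S/𝔓₀ ∩ E)ˣ = 1951^f - 1`.
[cite: SerreLocalFields1979, Ch. VI §2 Cor. 1' and Ch. IV §2 Prop. 7, Cor. 1]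
-/
set_option linter.dupNamespace false -- project-wide option (lakefile weak.linter.dupNamespace); `Summit.Langlands.Langlands` is the mandated namespace

noncomputable section

open scoped MatrixGroups Matrix NumberField Classical
open Literature.NumberTheory.GaloisRepresentations IsDedekindDomain NumberField
open Field
open Summit.Langlands Rat.HeightOneSpectrum

namespace Summit.Langlands.Langlands.Theorems.CorrespondentFingerprint

variable {ℓ : ℕ} [Fact ℓ.Prime]

/-- **`a_v(ρ) = 1`** for a framed `ρ : Γ_ℚ → GL₂(ℚ̄_ℓ)` with `N(ρ) = 1951` unramified at every
`q_w ≠ 1951`, at the place `v` with `q_v = 1951`: the conductor ideal is `v^{a_v}` (all other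
exponents vanish, `artinConductorExponent_eq_zero_of_isUnramifiedAt_holds`) of norm `1951^{a_v}`.
[cite: SerreLocalFields1979, Ch. VI §3] -/
theorem artinConductorExponent_eq_one_of_artinConductorNat (ρ : FramedGaloisRep ℚ (PadicAlgCl ℓ) 2)
    (hcond : ρ.toGaloisRep.artinConductorNat = 1951)
    (hunr : ∀ w : HeightOneSpectrum (𝓞 ℚ), w.residueCard ≠ 1951 → ρ.IsUnramifiedAt w)
    {v : HeightOneSpectrum (𝓞 ℚ)} (hv : v.residueCard = 1951) :
    ρ.toGaloisRep.artinConductorExponent v = 1 := by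
  classical
  have h0 : ∀ w : HeightOneSpectrum (𝓞 ℚ), w ≠ v → ρ.toGaloisRep.artinConductorExponent w = 0 := by
    intro w hw
    refine GaloisRep.artinConductorExponent_eq_zero_of_isUnramifiedAt_holds ?_
    rw [FramedGaloisRep.isUnramifiedAt_toGaloisRep_iff]
    refine hunr w fun hw' => hw ?_
    have hgen : natGenerator w = natGenerator v := by
      rw [← Rat.residueCard_eq_natGenerator, ← Rat.residueCard_eq_natGenerator, hw', hv]
    exact (primesEquiv (R := 𝓞 ℚ)).injective (Subtype.ext hgen)
  have hprod : ρ.toGaloisRep.artinConductor =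
      v.asIdeal ^ ρ.toGaloisRep.artinConductorExponent v := by
    rw [GaloisRep.artinConductor]
    exact finprod_eq_single (fun w : HeightOneSpectrum (𝓞 ℚ) =>
      w.asIdeal ^ ρ.toGaloisRep.artinConductorExponent w) v fun w hw => by rw [h0 w hw, pow_zero]
  have hnorm : (1951 : ℕ) ^ ρ.toGaloisRep.artinConductorExponent v = 1951 := by
    have h1 := hcond
    rw [GaloisRep.artinConductorNat, hprod, map_pow] at h1
    change v.residueCard ^ _ = 1951 at h1
    rwa [hv] at h1
  exact (Nat.pow_eq_self_iff (by norm_num)).mp hnorm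

/-- **`a_{𝔓}(ρ) = 1` at every prime `𝔓 ∣ v`** (same hypotheses, plus finite image): the exponent
`a_v(ρ) ∈ ℕ` IS the real number `a_𝔓(ρ) = codim V^{I_𝔓} + Sw_𝔓(ρ)` by the Hausdorff form of the
integrality of the conductor (`natCast_artinConductorExponent_of_t2Space_of_arith_charZero`, fed with
the discharged Hasse–Arf input `card_inf_inertia_dvd_finsum_card_inf_ramificationSubgroup_holds`;
finite image gives finite wild image). [cite: SerreLocalFields1979, Ch. VI §2 Thm 1'] -/
theorem artinConductorAt_eq_one_of_artinConductorNat (ρ : FramedGaloisRep ℚ (PadicAlgCl ℓ) 2)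
    (hfin : (Set.range ρ).Finite) (hcond : ρ.toGaloisRep.artinConductorNat = 1951)
    (hunr : ∀ w : HeightOneSpectrum (𝓞 ℚ), w.residueCard ≠ 1951 → ρ.IsUnramifiedAt w)
    {v : HeightOneSpectrum (𝓞 ℚ)} (hv : v.residueCard = 1951)
    {𝔓 : Ideal (absIntegers (𝓞 ℚ) ℚ)} (h𝔓 : 𝔓 ∈ v.primesAbove) :
    ρ.toGaloisRep.artinConductorAt (𝓞 ℚ) 𝔓 = 1 := by
  have hrange : (Set.range ⇑ρ.toGaloisRep).Finite := by
    refine (hfin.image fun g : GL (Fin 2) (PadicAlgCl ℓ) =>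
      glStdRepresentation (Fin 2) (PadicAlgCl ℓ) g).subset ?_
    rintro _ ⟨σ, rfl⟩
    exact ⟨ρ σ, ⟨σ, rfl⟩, rfl⟩
  have hwild : ρ.toGaloisRep.HasFiniteWildImageAt (𝓞 ℚ) 𝔓 :=
    hrange.subset (Set.image_subset_range _ _)
  have hchar : ((v.residueCard : ℕ) : PadicAlgCl ℓ) ≠ 0 := by
    rw [hv]; norm_num
  have key := GaloisRep.natCast_artinConductorExponent_of_t2Space_of_arith_charZero
    (K := ℚ) (fun R _ _ E => card_inf_inertia_dvd_finsum_card_inf_ramificationSubgroup_holds R)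
    h𝔓 ρ.toGaloisRep hchar hwild
  rw [artinConductorExponent_eq_one_of_artinConductorNat ρ hcond hunr hv, Nat.cast_one] at key
  exact key.symm

/-- **`codim V^{I_𝔓} = 1`** at every `𝔓 ∣ v` (same hypotheses): `a_𝔓(ρ) = codim V^{I_𝔓} + Sw_𝔓(ρ) = 1`
with `Sw ≥ 0` forces `codim V^{I_𝔓} ≤ 1`, and `codim V^{I_𝔓} = 0` would make `I_𝔓` act trivially,
whence `a_𝔓(ρ) = 0` (`IsUnramifiedAtPrime.artinConductorAt_eq_zero_holds`).
[cite: SerreLocalFields1979, Ch. VI §2 Cor. 1'] -/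
theorem codimFixed_inertia_eq_one_of_artinConductorNat (ρ : FramedGaloisRep ℚ (PadicAlgCl ℓ) 2)
    (hfin : (Set.range ρ).Finite) (hcond : ρ.toGaloisRep.artinConductorNat = 1951)
    (hunr : ∀ w : HeightOneSpectrum (𝓞 ℚ), w.residueCard ≠ 1951 → ρ.IsUnramifiedAt w)
    {v : HeightOneSpectrum (𝓞 ℚ)} (hv : v.residueCard = 1951)
    {𝔓 : Ideal (absIntegers (𝓞 ℚ) ℚ)} (h𝔓 : 𝔓 ∈ v.primesAbove) :
    ρ.toGaloisRep.codimFixed (𝔓.inertia (absoluteGaloisGroup ℚ)) = 1 := by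
  have ha := artinConductorAt_eq_one_of_artinConductorNat ρ hfin hcond hunr hv h𝔓
  rw [GaloisRep.artinConductorAt_def] at ha
  have hsw := ρ.toGaloisRep.swanConductorAt_nonneg (R := 𝓞 ℚ) 𝔓
  have hle : (ρ.toGaloisRep.codimFixed (𝔓.inertia (absoluteGaloisGroup ℚ)) : ℝ) ≤ 1 := by
    linarith
  have hne : ρ.toGaloisRep.codimFixed (𝔓.inertia (absoluteGaloisGroup ℚ)) ≠ 0 := by
    intro h0
    rw [ContinuousRep.codimFixed_eq_zero_iff] at h0
    have h1 : ρ.toGaloisRep.artinConductorAt (𝓞 ℚ) 𝔓 = 0 :=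
      GaloisRep.IsUnramifiedAtPrime.artinConductorAt_eq_zero_holds h0
    rw [artinConductorAt_eq_one_of_artinConductorNat ρ hfin hcond hunr hv h𝔓] at h1
    exact one_ne_zero h1
  have hle' : ρ.toGaloisRep.codimFixed (𝔓.inertia (absoluteGaloisGroup ℚ)) ≤ 1 := by
    exact_mod_cast hle
  omega

/-- **A fixed line and non-triviality of `ρ(I_𝔓)`** (same hypotheses): `codim V^{I_𝔓} = 1` on
`V = ℚ̄_ℓ²` gives a non-zero vector fixed by `ρ(I_𝔓)` and an element of `I_𝔓` acting non-trivially.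
[cite: SerreLocalFields1979, Ch. VI §2 Cor. 1'] -/
theorem exists_fixed_and_exists_ne_one_of_artinConductorNat (ρ : FramedGaloisRep ℚ (PadicAlgCl ℓ) 2)
    (hfin : (Set.range ρ).Finite) (hcond : ρ.toGaloisRep.artinConductorNat = 1951)
    (hunr : ∀ w : HeightOneSpectrum (𝓞 ℚ), w.residueCard ≠ 1951 → ρ.IsUnramifiedAt w)
    {v : HeightOneSpectrum (𝓞 ℚ)} (hv : v.residueCard = 1951)
    {𝔓 : Ideal (absIntegers (𝓞 ℚ) ℚ)} (h𝔓 : 𝔓 ∈ v.primesAbove) :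
    (∃ e : Fin 2 → PadicAlgCl ℓ, e ≠ 0 ∧ ∀ g ∈ 𝔓.inertia (absoluteGaloisGroup ℚ),
        ((ρ g : GL (Fin 2) (PadicAlgCl ℓ)) : Matrix (Fin 2) (Fin 2) (PadicAlgCl ℓ)) *ᵥ e = e) ∧
    ∃ g ∈ 𝔓.inertia (absoluteGaloisGroup ℚ), ρ g ≠ 1 := by
  have hc := codimFixed_inertia_eq_one_of_artinConductorNat ρ hfin hcond hunr hv h𝔓
  refine ⟨?_, ?_⟩
  · have hfr : Module.finrank (PadicAlgCl ℓ)
        (ρ.toGaloisRep.fixedSubmodule (𝔓.inertia (absoluteGaloisGroup ℚ))) = 1 := by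
      have h1 := ρ.toGaloisRep.codimFixed_eq_finrank_sub (𝔓.inertia (absoluteGaloisGroup ℚ))
      have h2 := Submodule.finrank_le (ρ.toGaloisRep.fixedSubmodule (𝔓.inertia (absoluteGaloisGroup ℚ)))
      rw [hc] at h1
      rw [Module.finrank_fin_fun] at h1 h2
      omega
    obtain ⟨e, he, he0⟩ := Submodule.exists_mem_ne_zero_of_ne_bot
      (p := ρ.toGaloisRep.fixedSubmodule (𝔓.inertia (absoluteGaloisGroup ℚ))) fun h => by
      rw [h, finrank_bot] at hfr; exact zero_ne_one hfr
    exact ⟨e, he0, fun g hg => (ContinuousRep.mem_fixedSubmodule ρ.toGaloisRep _ _).mp he g hg⟩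
  · by_contra hall
    push Not at hall
    refine one_ne_zero (hc.symm.trans ?_)
    rw [ContinuousRep.codimFixed_eq_zero_iff]
    intro σ hσ
    exact (FramedRep.toRepresentation_apply_eq_one_iff ρ σ).mpr (hall σ hσ)

-- instance search through `integralClosure R E` is deep (cf. `ArtinConductorWildProofs`)
set_option synthInstance.maxHeartbeats 200000 in
/-- **`g^m ∈ G_1` for every `g ∈ G_0`, with `p ∤ m`**, at the prime `𝔓 ∩ E` of a finite separable
layer `E/K ⊆ K̄` (`R` Dedekind with fraction field `K`, `𝔓` a maximal ideal of `\bar ℤ_K` with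
`p ∈ 𝔓 ∩ R ≠ 0` and `R/(𝔓 ∩ R)` finite): the tame character `θ₀ : G_0 → (S/(𝔓 ∩ E))ˣ` has kernel exactly
`G_1` (`exists_inertia_hom_units_ker_eq`, Serre IV §2 Prop. 7), and the unit group of the finite
field `S/(𝔓 ∩ E)` of characteristic `p` has order `m = p^f - 1`, prime to `p`.  Stated for generic
coefficients `R` (instance path of `integralClosure R E` as in `integralClosureToAbsIntegers`).
[cite: SerreLocalFields1979, Ch. IV §2 Prop. 7 and Cor. 1] -/
theorem exists_pow_mem_ramificationSubgroup_one {K : Type} [Field K] (R : Type*) [CommRing R]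
    [IsDedekindDomain R] [Algebra R K] [IsFractionRing R K] (𝔓 : Ideal (absIntegers R K))
    [𝔓.IsMaximal] [Finite (R ⧸ 𝔓.under R)] (h0 : 𝔓.under R ≠ ⊥) {p : ℕ} (hp : p.Prime)
    (hpR : (p : R) ∈ 𝔓.under R) (E : IntermediateField K (AlgebraicClosure K))
    [FiniteDimensional K E] [Algebra.IsSeparable K E] :
    ∃ m : ℕ, 0 < m ∧ ¬ p ∣ m ∧
      ∀ g ∈ (𝔓.comap (E.integralClosureToAbsIntegers R)).inertia (E ≃ₐ[K] E),
        g ^ m ∈ (𝔓.comap (E.integralClosureToAbsIntegers R)).ramificationSubgroup (E ≃ₐ[K] E) 1 := by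
  classical
  haveI : IsDedekindDomain (integralClosure R E) := integralClosure.isDedekindDomain R K E
  haveI := isMaximal_comap_integralClosureToAbsIntegers R 𝔓 E
  have hunder := under_comap_integralClosureToAbsIntegers R 𝔓 E
  -- finite residue ring of `𝔓 ∩ E`
  haveI : Finite (integralClosure R E ⧸ 𝔓.comap (E.integralClosureToAbsIntegers R)) := by
    haveI : Module.Finite R (integralClosure R E) :=
      IsIntegralClosure.finite R K E (integralClosure R E)
    haveI : (𝔓.comap (E.integralClosureToAbsIntegers R)).LiesOver (𝔓.under R) := ⟨hunder.symm⟩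
    haveI : Module.Finite (R ⧸ 𝔓.under R)
        (integralClosure R E ⧸ 𝔓.comap (E.integralClosureToAbsIntegers R)) :=
      module_finite_of_liesOver _ _
    exact Module.finite_of_finite (R ⧸ 𝔓.under R)
  have hpE : ((p : ℕ) : integralClosure R E) ∈ 𝔓.comap (E.integralClosureToAbsIntegers R) := by
    rw [Ideal.mem_comap, map_natCast]
    rw [Ideal.under_def, Ideal.mem_comap, map_natCast] at hpR
    exact hpR
  have h0' : 𝔓.comap (E.integralClosureToAbsIntegers R) ≠ ⊥ := by
    intro h
    apply h0
    rw [← hunder, h]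
    refine Ideal.comap_bot_of_injective _ fun x y hxy => ?_
    have hxy' : algebraMap R E x = algebraMap R E y := by
      have := congrArg (fun z : integralClosure R E => (z : E)) hxy
      simpa only [Subalgebra.coe_algebraMap] using this
    rw [IsScalarTower.algebraMap_apply R K E, IsScalarTower.algebraMap_apply R K E] at hxy'
    exact IsFractionRing.injective R K ((algebraMap K E).injective hxy')
  obtain ⟨θ, hθ⟩ := exists_inertia_hom_units_ker_eq _ (E ≃ₐ[K] E) h0'
  letI : Field (integralClosure R E ⧸ 𝔓.comap (E.integralClosureToAbsIntegers R)) :=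
    Ideal.Quotient.field _
  refine ⟨Nat.card (integralClosure R E ⧸ 𝔓.comap (E.integralClosureToAbsIntegers R))ˣ,
    Nat.card_pos, ?_, fun g hg => ?_⟩
  · haveI : Fact p.Prime := ⟨hp⟩
    haveI : CharP (integralClosure R E ⧸ 𝔓.comap (E.integralClosureToAbsIntegers R)) p := by
      rw [CharP.charP_iff_prime_eq_zero hp]
      exact (Ideal.Quotient.eq_zero_iff_mem).mpr hpE
    letI : Fintype (integralClosure R E ⧸ 𝔓.comap (E.integralClosureToAbsIntegers R)) :=
      Fintype.ofFinite _
    obtain ⟨f, -, hf⟩ :=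
      FiniteField.card (integralClosure R E ⧸ 𝔓.comap (E.integralClosureToAbsIntegers R)) p
    rw [Nat.card_units, Nat.card_eq_fintype_card, hf]
    intro hdvd
    have h1 : p ∣ p ^ (f : ℕ) := dvd_pow_self p (PNat.ne_zero f)
    have h2 : p ∣ p ^ (f : ℕ) - (p ^ (f : ℕ) - 1) := Nat.dvd_sub h1 hdvd
    rw [Nat.sub_sub_self (Nat.one_le_pow _ _ hp.pos)] at h2
    exact hp.one_lt.ne' (Nat.dvd_one.mp h2)
  · have hpow := (hθ (⟨g, hg⟩ ^
      Nat.card (integralClosure R E ⧸ 𝔓.comap (E.integralClosureToAbsIntegers R))ˣ)).mp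
        (by rw [map_pow, pow_card_eq_one'])
    simpa only [SubgroupClass.coe_pow] using hpow

/-- **`Sw_𝔓(ρ) = 0` and finite image give tameness with exponent prime to `p`.**  For a number
field `K`, a finite-image framed `ρ : Γ_K → GL_n(A)` (`A` a field, `GL_n(A)` a `T₁` space), a prime
`𝔓 ∣ v` of `\bar ℤ_K` with `p ∈ v`, `p` prime: if `Sw_𝔓(ρ) = 0` then there is `m ≥ 1` with `p ∤ m`
and `ρ(g)^m = 1` for every `g ∈ I_𝔓`.  Factor `ρ` through a finite Galois `Gal(E/K)` (the kernel is
open, `isOpen_ker_of_finite_range`, so it contains some `Gal(K̄/E)`,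
`krullTopology_mem_nhds_one_iff_of_normal`); in the lower-numbering formula
`a_𝔓(ρ) = Σ_i (g_i/g_0) codim V^{G_i}` (`artinConductorAt_eq_finsum_ramificationSubgroup_holds`) the
`i = 0` term is `≥ codim V^{I_𝔓} = a_𝔓(ρ)` (`I_𝔓|_E ≤ G_0`), so the `i = 1` term vanishes and `G_1`
acts trivially; the tame character `θ₀ : G_0 → (S/(𝔓 ∩ E))ˣ` has kernel exactly `G_1`
(`exists_inertia_hom_units_ker_eq`), so `m = #(S/(𝔓 ∩ E))ˣ = p^f - 1` works.
[cite: SerreLocalFields1979, Ch. VI §2 Cor. 1' and Ch. IV §2 Prop. 7, Cor. 1] -/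
theorem exists_pow_eq_one_of_swanConductorAt_eq_zero {K : Type} [Field K] [NumberField K]
    {A : Type*} [Field A] [TopologicalSpace A] [IsTopologicalRing A] {n : ℕ}
    [T1Space (GL (Fin n) A)] (ρ : FramedGaloisRep K A n) (hfin : (Set.range ρ).Finite)
    {v : HeightOneSpectrum (𝓞 K)} {𝔓 : Ideal (absIntegers (𝓞 K) K)} (h𝔓 : 𝔓 ∈ v.primesAbove)
    (hsw : ρ.toGaloisRep.swanConductorAt (𝓞 K) 𝔓 = 0) {p : ℕ} (hp : p.Prime)
    (hpv : (p : 𝓞 K) ∈ v.asIdeal) :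
    ∃ m : ℕ, 0 < m ∧ ¬ p ∣ m ∧ ∀ g ∈ 𝔓.inertia (absoluteGaloisGroup K), ρ g ^ m = 1 := by
  classical
  haveI : 𝔓.IsPrime := h𝔓.1
  haveI : 𝔓.IsMaximal := HeightOneSpectrum.isMaximal_of_mem_primesAbove h𝔓
  -- a finite Galois layer `E/K` through which `ρ` factors
  haveI : Finite ρ.toMonoidHom.range := by
    have h : ((ρ.toMonoidHom.range : Subgroup (GL (Fin n) A)) : Set (GL (Fin n) A)).Finite := by
      rw [MonoidHom.coe_range]
      exact hfin
    exact h.to_subtype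
  have hopen := isOpen_ker_of_finite_range ρ
  have hnhds : ((ρ.toMonoidHom.ker : Subgroup (absoluteGaloisGroup K)) : Set (absoluteGaloisGroup K)) ∈
      nhds (1 : absoluteGaloisGroup K) := hopen.mem_nhds (Subgroup.one_mem _)
  obtain ⟨E, hEfd, hEn, hE⟩ :=
    (krullTopology_mem_nhds_one_iff_of_normal K (AlgebraicClosure K) _).mp hnhds
  haveI := hEfd
  haveI := hEn
  haveI : Algebra.IsSeparable K E := Algebra.IsSeparable.of_integral K E
  have hker : ∀ σ : absoluteGaloisGroup K, absRestrictNormalHom E σ = 1 → ρ σ = 1 := by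
    intro σ hσ
    have hmem : absoluteGaloisGroup.toAlgEquiv K σ ∈ E.fixingSubgroup := by
      rw [← IntermediateField.restrictNormalHom_ker, MonoidHom.mem_ker]
      exact hσ
    exact (MonoidHom.mem_ker).mp (hE hmem)
  have hkerG : ∀ σ : absoluteGaloisGroup K, absRestrictNormalHom E σ = 1 → ρ.toGaloisRep σ = 1 :=
    fun σ hσ => (FramedRep.toRepresentation_apply_eq_one_iff ρ σ).mpr (hker σ hσ)
  -- the lower-numbering formula `a_𝔓(ρ) = Σ_i (g_i/g_0) codim V^{G_i}` with `a_𝔓(ρ) = codim V^{I_𝔓}`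
  set 𝔓E := 𝔓.comap (E.integralClosureToAbsIntegers (𝓞 K)) with h𝔓E
  set G := fun i : ℕ => 𝔓E.ramificationSubgroup (E ≃ₐ[K] E) i with hG
  set t : ℕ → ℝ := fun i => ((Nat.card (G i) : ℝ) / Nat.card (G 0)) *
    (ρ.toGaloisRep.codimFixed ((G i).comap (absRestrictNormalHom E)) : ℝ) with ht
  have hformula : ∑ᶠ i, t i = ρ.toGaloisRep.codimFixed (𝔓.inertia (absoluteGaloisGroup K)) := by
    have h := GaloisRep.artinConductorAt_eq_finsum_ramificationSubgroup_holds h𝔓 E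
      ρ.toGaloisRep hkerG
    rw [GaloisRep.artinConductorAt_def, hsw, add_zero] at h
    exact h.symm
  have hnn : ∀ i, 0 ≤ t i := fun i => by positivity
  have hG0pos : (0 : ℝ) < Nat.card (G 0) := by exact_mod_cast (Nat.card_pos (α := G 0))
  have hG1pos : (0 : ℝ) < Nat.card (G 1) := by exact_mod_cast (Nat.card_pos (α := G 1))
  -- the `i = 0` term is `≥ codim V^{I_𝔓}`
  have hI0 : 𝔓.inertia (absoluteGaloisGroup K) ≤ (G 0).comap (absRestrictNormalHom E) := by
    rw [← Subgroup.map_le_iff_le_comap, hG]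
    simp only [Ideal.ramificationSubgroup_zero]
    exact inertia_map_absRestrictNormalHom_le (R := 𝓞 K) 𝔓 E
  have hc0 : ρ.toGaloisRep.codimFixed (𝔓.inertia (absoluteGaloisGroup K)) ≤
      ρ.toGaloisRep.codimFixed ((G 0).comap (absRestrictNormalHom E)) := by
    rw [ContinuousRep.codimFixed_eq_finrank_sub, ContinuousRep.codimFixed_eq_finrank_sub]
    exact Nat.sub_le_sub_left
      (Submodule.finrank_mono (ρ.toGaloisRep.fixedSubmodule_antitone hI0)) _
  have ht0 : (ρ.toGaloisRep.codimFixed (𝔓.inertia (absoluteGaloisGroup K)) : ℝ) ≤ t 0 := by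
    have h1 : t 0 = ρ.toGaloisRep.codimFixed ((G 0).comap (absRestrictNormalHom E)) := by
      simp only [ht]
      rw [div_self hG0pos.ne', one_mul]
    rw [h1]
    exact_mod_cast hc0
  -- the sum is finite (`G_i = 1` for `i ≫ 0` and `ρ` is trivial on `Gal(K̄/E)`)
  have hsupp : (Function.support t).Finite := by
    obtain ⟨N, hN⟩ := ramificationSubgroup_comap_eventually_eq_bot (𝓞 K) 𝔓 E
    refine (Set.finite_Iio N).subset fun i hi => ?_
    rw [Function.mem_support] at hi
    by_contra hle
    rw [Set.mem_Iio, not_lt] at hle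
    apply hi
    simp only [ht, hG]
    rw [hN i hle, ContinuousRep.codimFixed_eq_zero_of_forall_eq_one ρ.toGaloisRep
      (fun σ hσ => hkerG σ (by rwa [Subgroup.mem_comap, Subgroup.mem_bot] at hσ)),
      Nat.cast_zero, mul_zero]
  -- hence the `i = 1` term vanishes: `G_1` acts trivially
  have ht1 : t 1 = 0 := by
    by_contra hne
    have h1mem : (1 : ℕ) ∈ hsupp.toFinset := by
      rw [Set.Finite.mem_toFinset, Function.mem_support]
      exact hne
    have hle : t 0 + t 1 ≤ ∑ᶠ i, t i := by
      rw [finsum_eq_sum t hsupp]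
      by_cases h0mem : (0 : ℕ) ∈ hsupp.toFinset
      · have hsub : ({0, 1} : Finset ℕ) ⊆ hsupp.toFinset := by
          intro i hi
          simp only [Finset.mem_insert, Finset.mem_singleton] at hi
          rcases hi with rfl | rfl
          exacts [h0mem, h1mem]
        calc t 0 + t 1 = ∑ i ∈ ({0, 1} : Finset ℕ), t i := by simp
          _ ≤ ∑ i ∈ hsupp.toFinset, t i :=
            Finset.sum_le_sum_of_subset_of_nonneg hsub fun i _ _ => hnn i
      · have h00 : t 0 = 0 := by
          rw [Set.Finite.mem_toFinset, Function.mem_support, not_not] at h0mem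
          exact h0mem
        rw [h00, zero_add]
        exact Finset.single_le_sum (fun i _ => hnn i) h1mem
    rw [hformula] at hle
    have : t 1 ≤ 0 := by linarith
    exact hne (le_antisymm this (hnn 1))
  have hG1 : ∀ σ ∈ (G 1).comap (absRestrictNormalHom E), ρ.toGaloisRep σ = 1 := by
    rw [← ContinuousRep.codimFixed_eq_zero_iff]
    simp only [ht, mul_eq_zero, div_eq_zero_iff, Nat.cast_eq_zero] at ht1
    rcases ht1 with (h1 | h1) | h1
    · exact absurd h1 (by exact_mod_cast hG1pos.ne')
    · exact absurd h1 (by exact_mod_cast hG0pos.ne')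
    · exact h1
  -- `g^m ∈ G_1` on `G_0` with `p ∤ m` (tame character), hence `ρ(g)^m = 1` on `I_𝔓`
  have hover : v.asIdeal = 𝔓.under (𝓞 K) := h𝔓.2.over
  haveI : Finite (𝓞 K ⧸ 𝔓.under (𝓞 K)) := by
    rw [← hover]
    exact Ideal.finiteQuotientOfFreeOfNeBot v.asIdeal v.ne_bot
  have hpR : ((p : ℕ) : 𝓞 K) ∈ 𝔓.under (𝓞 K) := by rwa [← hover]
  have h0 : 𝔓.under (𝓞 K) ≠ ⊥ := by
    rw [← hover]
    exact v.ne_bot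
  obtain ⟨m, hm, hpm, hmem⟩ := exists_pow_mem_ramificationSubgroup_one (𝓞 K) 𝔓 h0 hp hpR E
  refine ⟨m, hm, hpm, fun g hg => ?_⟩
  have hg0 : absRestrictNormalHom E g ∈ 𝔓E.inertia (E ≃ₐ[K] E) := by
    have := hI0 hg
    rw [Subgroup.mem_comap, hG] at this
    simpa only [Ideal.ramificationSubgroup_zero] using this
  have hgm : g ^ m ∈ (G 1).comap (absRestrictNormalHom E) := by
    rw [Subgroup.mem_comap, map_pow]
    exact hmem _ hg0
  have h1 : ρ (g ^ m) = 1 := (FramedRep.toRepresentation_apply_eq_one_iff ρ _).mp (hG1 _ hgm)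
  rwa [map_pow] at h1

/-- **Sub-goal `stub_local1951_galois_conductor`** (registered): the global half of the Galois side
at `1951` for the stub `stub_local1951_galois` (C1).  For a framed finite-image
`ρ : Γ_ℚ → GL₂(ℚ̄_ℓ)` with `N(ρ) = 1951`, unramified at every `q_w ≠ 1951`, and `q_v = 1951`, with
`𝔓₀ = adicCompletionPrime ℚ v` and `I₀ = I_{𝔓₀}`: a non-zero vector of `ℚ̄_ℓ²` fixed by `ρ(I₀)`,
an element of `I₀` acting non-trivially, and an exponent `m ≥ 1`, `1951 ∤ m`, killing `ρ(I₀)`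
(`a_{𝔓₀}(ρ) = 1` by integrality, so `codim V^{I₀} = 1` and `Sw = 0`; then
`exists_pow_eq_one_of_swanConductorAt_eq_zero`).
[cite: SerreLocalFields1979, Ch. VI §2 Thm 1', Cor. 1' and Ch. IV §2 Prop. 7, Cor. 1] -/
theorem stub_local1951_galois_conductor : ∀ (ℓ : ℕ) [Fact ℓ.Prime]
    (ρ : FramedGaloisRep ℚ (PadicAlgCl ℓ) 2), (Set.range ρ).Finite →
    ρ.toGaloisRep.artinConductorNat = 1951 →
    (∀ v : HeightOneSpectrum (𝓞 ℚ), v.residueCard ≠ 1951 → ρ.IsUnramifiedAt v) →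
    ∀ (v : HeightOneSpectrum (𝓞 ℚ)), v.residueCard = 1951 →
    (∃ e : Fin 2 → PadicAlgCl ℓ, e ≠ 0 ∧
      ∀ g ∈ (adicCompletionPrime ℚ v).inertia (absoluteGaloisGroup ℚ),
        ((ρ g : GL (Fin 2) (PadicAlgCl ℓ)) : Matrix (Fin 2) (Fin 2) (PadicAlgCl ℓ)) *ᵥ e = e) ∧
    (∃ g ∈ (adicCompletionPrime ℚ v).inertia (absoluteGaloisGroup ℚ), ρ g ≠ 1) ∧
    ∃ m : ℕ, 0 < m ∧ ¬ 1951 ∣ m ∧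
      ∀ g ∈ (adicCompletionPrime ℚ v).inertia (absoluteGaloisGroup ℚ), ρ g ^ m = 1 := by
  intro ℓ _ ρ hfin hcond hunr v hv
  have h𝔓 := adicCompletionPrime_mem_primesAbove ℚ v
  obtain ⟨he, hg⟩ := exists_fixed_and_exists_ne_one_of_artinConductorNat ρ hfin hcond hunr hv h𝔓
  refine ⟨he, hg, ?_⟩
  have hsw : ρ.toGaloisRep.swanConductorAt (𝓞 ℚ) (adicCompletionPrime ℚ v) = 0 := by
    have ha := artinConductorAt_eq_one_of_artinConductorNat ρ hfin hcond hunr hv h𝔓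
    rw [GaloisRep.artinConductorAt_def,
      codimFixed_inertia_eq_one_of_artinConductorNat ρ hfin hcond hunr hv h𝔓, Nat.cast_one] at ha
    linarith
  have hpv : ((1951 : ℕ) : 𝓞 ℚ) ∈ v.asIdeal := by
    rw [Rat.natCast_mem_asIdeal_iff, ← Rat.residueCard_eq_natGenerator, hv]
  exact exists_pow_eq_one_of_swanConductorAt_eq_zero ρ hfin h𝔓 hsw (by norm_num) hpv

end Summit.Langlands.Langlands.Theorems.CorrespondentFingerprint

end
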